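/-
Copyright (c) 2026 the pub-hodgecm-mathlib formalisation cell (harness21).  Prover seat hodgecm-mathlib-K2E3-p03 (g3), Track B «K2-LIT» ∕ h413
(stmt-HodgeConjecture-24833), ‹S› ROAD J ∕ R3 «RANK-ONE MASS», (d-w)-class of letter ‹J3› v2 (leaf (J3d-w), dyadic ramified), letters W1 «WILD KIT» + the BLOCK MODEL OF THE
COMPACT SHEET AT ANY RAMIFIED PLACE (dealer K2E3-plan (g2) DEAL (D26) 02:28Z; CENSUS `K2/K2E3-p03/g3/CENSUS-J3dw.K2E3-p03-g3.md` §3 W1, §4).  2026-09-04.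
-/
import Summits.HodgeConjecture.HodgeConjecture.Theorems.K2E3CompactSheetBlockModelRamified   -- ★ R3g-ram p856749 (K2E3-p17 g4): brings ★ R3g p856521 + kit p856451 (the place-free local algebra), ★ p856712, ★ `conjLocal_apply_eq_of_smul_eq`
import Summits.HodgeConjecture.HodgeConjecture.Theorems.F0P3cDyRamWildPlaceDatum             -- ★ p854601 (LH4-p02): `exists_isRamifiedQuadraticDatum_of_placesOver` (the ramified quadratic datum of `L_w ∕ L⁺_v`, tame or wild)
import Literature.NumberTheory.LocalFields.WildQuadraticDatumNonNormUnit                     -- ★ `exists_fixed_unit_not_norm_of_isRamifiedQuadraticDatum` (Serre V §3 Cor. 2∕3: `[U_F : N U_E] ≥ 2`, tame AND wild)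
import Literature.NumberTheory.LocalFields.CompleteValuedSquareRootNearOne                    -- ★ `exists_mul_self_eq_of_valued_sub_one_lt_four_adicCompletion` (squares near `1` at any residue characteristic)
import HarnessLib

/-!
# ‹S› road J ∕ R3, class (d-w) — W1 «A GLOBAL NON-NORM UNIT AT ANY RAMIFIED PLACE» and the BLOCK MODEL OF THE COMPACT SHEET AT ANY RAMIFIED PLACE (tame or wild)
# (Serre 1979 V §3 Cor. 2–3; Rogawski 1990 §3.8 Prop. 3.8.1 (a),(d) p. 30, §8.1 p. 116; Jacobowitz 1962 §3, §§7–8)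

Cell `pub/hodgecm-mathlib`, Track B «K2-LIT», crux H413 = `stmt-HodgeConjecture-24833`; ‹S› ROAD J, letter ‹J3› (v2), residue class (J3d-w)
`U3bCentralGermsLeaves.sig_K2E3CompatibleMeasureEPIdentityRankOneDyadicRamified` (PART C :333), payer road (d-w) (owner K2E3-p03 (g3), DEAL (D26)).
THEOREMS ONLY (no definition, no instance, no notation, no named fact, no `sorry`); lane `--supports stmt-HodgeConjecture-24833 --as helper`.

WHY.  ★ R3g-ram p856749 `exists_blockModel_compactSheet_ramified` (K2E3-p17 (g4)) carries `2 ∉ v` ONLY through its kit ★ p856712 (K2E3-p03 (g2)), which represents the non-trivial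
norm class at `w` by a unit of NON-SQUARE RESIDUE and outputs the valuation clause `hξN : ∀ u, |u|_w = 1 → |σ_w u·u − ξ|_w = 1`.  At a WILD place (`2 ∈ v`) every residue is a
square and `hξN` is unsatisfiable; what survives is the ALGEBRAIC clause `¬ ∃ t, t·σ_w t = ξ_w` — and that is all the block model needs.  THIS FILE: §1 the parity-free kit (W1 of the
census): a GLOBAL `ξ ∈ L⁺`, `|ξ|_w = 1`, `ξ_w ∉ N(L_w^×)`, at EVERY ramified place — local witness ★ `exists_fixed_unit_not_norm_of_isRamifiedQuadraticDatum` at the datum of the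
place ★ `exists_isRamifiedQuadraticDatum_of_placesOver` [Serre1979 V §3 Cor. 2 (tame), Cor. 3 (wild)], descended to `L⁺_v` (★ `exists_toPlace_eq_of_galAdicCompletionMap_eq`) and
approximated from `L⁺` within `|y − η₀|_v < |4|_v` (Mathlib `denseRange_algebraMap`), the quotient being a SQUARE of `L⁺_v` (★ `exists_mul_self_eq_of_valued_sub_one_lt_four_adicCompletion`),
hence a norm at `w` (`ι_w(r)² = ι_w(r)·σ_w ι_w(r)`); §2 its reading in `L ⊗ L⁺_v`; §3 the block model = ★ p856749 §2's proof TOKEN FOR TOKEN with `h2` dropped and `hξN ↦ hξnn` in the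
output (the (J3d-w) sheet mass S4-w consumes `hξnn` for the anisotropy ⇒ compactness of `U(⟨1,−ξ⟩)_v`, ★ `compactSpace_cmDatum_local_of_not_isIsotropic`).

* §1 **`exists_global_unit_not_norm`** `(he : e(w|v) ≠ 1) : ∃ ξ : L, c ξ = ξ ∧ |ξ|_w = 1 ∧ ¬ ∃ t, t·σ_w t = ξ_w` — tame or wild.
* §2 `exists_global_unit_not_norm_localRing_of_ramified` — §1 read in `L ⊗ L⁺_v = ∏_{w ∣ v} L_w`: `ι ξ` a `(c ⊗ 1)`-fixed unit, `ι ξ ≠ σ(z)·z` for every unit `z` (★ `conjLocal_apply_eq_of_smul_eq`).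
* §3 **`exists_blockModel_compactSheet_of_ramified`** — the output binders `(ξ cb hξc hξ1 hξnn hcb T hT x hau hx y hy)` of the (d-w) sheet mass (and, at `2 ∉ v`, of ★ S4 (r) p856688
  after ★ (U5) turns `hξnn` into `hξN`): `c_b ∈ {1, ξ}`, `ᵗ(σT)·H′_v·T = (⟨1, −ξ⟩ ⊕ᶠ ⟨c_b⟩)_v`, `mat x = a·1₂ ⊕ᶠ u·1₁`, `a − u` a unit, `φ_T x = ε′`.

HONEST LABEL: HC_CM is proved only modulo the 7 printed citations (2 remaining named inputs: hLiu418 = stmt-HodgeConjecture-24832, h413 = stmt-HodgeConjecture-24833) until rung 0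
closes; count-neutral helper (local algebra + local class field theory of a ramified quadratic extension, tame or wild); (J3d-w) is NOT proved here (its S3∕S4 masses remain).

## References
* [Serre1979] J.-P. Serre, *Local Fields*, GTM 67 (1979), Ch. V §3 Prop. 5, Cor. 2 (tame), Cor. 3 (wild: `[U_F : N U_E] = 2` at the break); Ch. XIV §4 (squares near `1`).
* [Rogawski1990] J. D. Rogawski, *Automorphic Representations of Unitary Groups in Three Variables*, Ann. of Math. Stud. 123 (1990), §3.8 Prop. 3.8.1 (a),(d) p. 30; §8.1 p. 116.
* [Jacobowitz1962] R. Jacobowitz, *Hermitian forms over local fields*, Amer. J. Math. 84 (1962), §3 Thm. 3.1, §5, §§7–11 (ramified normal forms, dyadic included).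
* [CasselsFrohlichANT1967] J. W. S. Cassels, A. Fröhlich (eds.), *Algebraic Number Theory* (1967), Ch. II §6 (density of `K` in `K_v`).
* [Omeara1963] O. T. O'Meara, *Introduction to Quadratic Forms* (1963), §63A–B (local squares, norm index two).
-/

set_option autoImplicit false
set_option linter.dupNamespace false

noncomputable section

open NumberField IsDedekindDomain Matrix ValuativeRel
open scoped ValuativeRel
open Literature.NumberTheory.Automorphic Literature.NumberTheory.Automorphic.UnitaryGroup Literature.NumberTheory.GaloisRepresentations
open Literature.NumberTheory.Rogawski1990 Literature.NumberTheory.Weil1982.UnitaryFinTopForm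
open Literature.NumberTheory.LocalFields Literature.NumberTheory.LocalFields.RamifiedPlaceUnitNorms
open Summit.HodgeConjecture.HodgeConjecture.Cruxes.H413.K2E3CompactSheetBlockModelKit
open Summit.HodgeConjecture.HodgeConjecture.Cruxes.H413.K2E3CompactSheetBlockModel
open Summit.HodgeConjecture.HodgeConjecture.Cruxes.H413.F0P3cDyRamWildPlaceDatum (exists_isRamifiedQuadraticDatum_of_placesOver)
open Literature.NumberTheory.LocalFields.WildQuadraticDatum (exists_fixed_unit_not_norm_of_isRamifiedQuadraticDatum)
open Literature.NumberTheory.Automorphic.UnitaryThreeFourFrame (IsRamifiedQuadraticDatum)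
open scoped MatrixGroups

namespace Summit.HodgeConjecture.HodgeConjecture.Cruxes.H413.K2E3CompactSheetBlockModelWild

variable (L : Type) [Field L] [NumberField L] [IsCMField L] (H' : Matrix (Fin 3) (Fin 3) L)
  (hherm : (H'.map (cmConjRingHom L))ᵀ = H') (hanis : ∀ x : Fin 3 → L, Literature.AlgebraicGeometry.ShimuraVarieties.hermForm (cmConjRingHom L) H' x x = 0 → x = 0)
  (v : HeightOneSpectrum (𝓞 ↥(maximalRealSubfield L))) (w : PlacesOver L v) (hw : IsCMField.complexConj L • w.1 = w.1)
  (he : v.asIdeal.ramificationIdx' w.1.asIdeal ≠ 1)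

/-! ## §1 W1: a global unit of `L⁺` which is not a norm at `w`, at ANY ramified place -/

section Kit

include hw he in
/-- **W1 «A GLOBAL NON-NORM UNIT AT ANY RAMIFIED PLACE» (tame or wild).**  For `w ∣ v` ramified (`e(w|v) ≠ 1`, `c • w = w`) there is `ξ ∈ L⁺ ⊂ L` (fixed by complex conjugation)
with `|ξ|_w = 1` whose image in `L_w` is NOT a norm `t·σ_w t`.  Local witness ★ `exists_fixed_unit_not_norm_of_isRamifiedQuadraticDatum` at the ramified quadratic datum of the place
(★ `exists_isRamifiedQuadraticDatum_of_placesOver`); it comes from `L⁺_v` (★ `exists_toPlace_eq_of_galAdicCompletionMap_eq`); a global `ξ₀ ∈ L⁺` with `|ξ₀ − η₀|_v < |4|_v` (Mathlib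
`denseRange_algebraMap`) differs from `η₀` by a SQUARE of `L⁺_v` (★ `exists_mul_self_eq_of_valued_sub_one_lt_four_adicCompletion`), i.e. by a norm at `w`.  The parity-free form of ★ p856712.
[cite: Serre1979, Ch. V §3 Cor. 2, Cor. 3; Ch. XIV §4] [cite: CasselsFrohlichANT1967, Ch. II §6] -/
theorem exists_global_unit_not_norm :
    ∃ ξ : L, IsCMField.complexConj L ξ = ξ ∧ Valued.v (algebraMap L (w.1.adicCompletion L) ξ) = 1 ∧
      ¬ ∃ t : w.1.adicCompletion L, t * galAdicCompletionMap (L := L) (IsCMField.complexConj L) hw t = algebraMap L (w.1.adicCompletion L) ξ := by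
  haveI : Algebra.IsQuadraticExtension ↥(maximalRealSubfield L) L := IsCMField.isQuadraticExtension L
  have hc1 : IsCMField.complexConj L ≠ 1 := IsCMField.complexConj_ne_one L
  -- (1) the ramified quadratic datum of the place and a local `σ_w`-fixed unit which is not a norm
  obtain ⟨ϖ, hϖ⟩ : ∃ ϖ : w.1.adicCompletion L, Valued.v ϖ = WithZero.exp (-1 : ℤ) := ⟨_, HeckeCharacter.valued_uniformizer (K := L) (v := w.1)⟩
  obtain ⟨d, t, hD⟩ := exists_isRamifiedQuadraticDatum_of_placesOver L w hw he ϖ hϖ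
  haveI := Literature.NumberTheory.Automorphic.isAdicComplete_valuedMaximalIdeal_valuedInteger_adicCompletion L w.1
  obtain ⟨η, hση, hη1, hηnn⟩ := exists_fixed_unit_not_norm_of_isRamifiedQuadraticDatum (galAdicCompletionMap (L := L) (IsCMField.complexConj L) hw) ϖ d t hD
  -- (2) it comes from `L⁺_v`
  obtain ⟨η₀, hη₀⟩ := exists_toPlace_eq_of_galAdicCompletionMap_eq (IsCMField.complexConj L) w hc1 hw η hση
  have hη₀1 : Valued.v η₀ = 1 := by
    have h := valued_toPlace_eq_sq_of_ramified L v w hw he η₀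
    rw [hη₀, hη1] at h
    exact (pow_eq_one_iff_of_nonneg zero_le two_ne_zero).1 h.symm
  have hη₀0 : η₀ ≠ 0 := fun h0 => by rw [h0, map_zero] at hη₀1; exact zero_ne_one hη₀1
  -- (3) approximate `η₀` by a global `ξ₀ ∈ L⁺` within `|y − η₀|_v < |4|_v`
  have h40 : (4 : v.adicCompletion ↥(maximalRealSubfield L)) ≠ 0 := by
    have h4 : ((4 : ℕ) : ↥(maximalRealSubfield L)) ≠ 0 := Nat.cast_ne_zero.2 (by norm_num)
    have h := (map_ne_zero (algebraMap ↥(maximalRealSubfield L) (v.adicCompletion ↥(maximalRealSubfield L)))).2 h4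
    rwa [map_natCast, Nat.cast_ofNat] at h
  have hv40 : Valued.v (4 : v.adicCompletion ↥(maximalRealSubfield L)) ≠ 0 := (Valuation.ne_zero_iff _).2 h40
  have h4le : Valued.v (4 : v.adicCompletion ↥(maximalRealSubfield L)) ≤ 1 := by
    -- naturals have valuation `≤ 1`
    have hnat : ∀ n : ℕ, Valued.v ((n : ℕ) : v.adicCompletion ↥(maximalRealSubfield L)) ≤ 1 := fun n => by
      induction n with
      | zero => simp
      | succ n ih =>
        rw [Nat.cast_succ]
        exact (Valuation.map_add _ _ _).trans (max_le ih (by rw [map_one]))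
    have h : ((4 : ℕ) : v.adicCompletion ↥(maximalRealSubfield L)) = 4 := by norm_cast
    rw [← h]
    exact hnat 4
  have hopen : IsOpen {y : v.adicCompletion ↥(maximalRealSubfield L) | Valued.v (y - η₀) < Valued.v (4 : v.adicCompletion ↥(maximalRealSubfield L))} := by
    have h1 : IsOpen {x : v.adicCompletion ↥(maximalRealSubfield L) | Valued.v x < Valued.v (4 : v.adicCompletion ↥(maximalRealSubfield L))} := by
      simpa only [Valuation.restrict_lt_iff] using
        Valued.isOpen_ball (v.adicCompletion ↥(maximalRealSubfield L)) (Valued.v.restrict (4 : v.adicCompletion ↥(maximalRealSubfield L)))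
    exact h1.preimage (continuous_id.sub continuous_const)
  obtain ⟨ξ₀, hξ₀⟩ := (HeightOneSpectrum.denseRange_algebraMap (K := ↥(maximalRealSubfield L)) v).exists_mem_open hopen
    ⟨η₀, by simp [pos_iff_ne_zero, hv40]⟩
  change Valued.v (algebraMap ↥(maximalRealSubfield L) (v.adicCompletion ↥(maximalRealSubfield L)) ξ₀ - η₀) < Valued.v (4 : v.adicCompletion ↥(maximalRealSubfield L)) at hξ₀
  set y : v.adicCompletion ↥(maximalRealSubfield L) := algebraMap ↥(maximalRealSubfield L) (v.adicCompletion ↥(maximalRealSubfield L)) ξ₀ with hydef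
  -- `|y|_v = 1` and `s := y ∕ η₀` is within `|4|` of `1`, hence a square `r·r`
  have hy1 : Valued.v y = 1 := by
    have h := Valuation.map_add_eq_of_lt_left (v := Valued.v) (x := η₀) (y := y - η₀) (by rw [hη₀1]; exact lt_of_lt_of_le hξ₀ h4le)
    rwa [add_sub_cancel, hη₀1] at h
  have hy0 : y ≠ 0 := fun h0 => by rw [h0, map_zero] at hy1; exact zero_ne_one hy1
  have hs : Valued.v (y * η₀⁻¹ - 1) < Valued.v (4 : v.adicCompletion ↥(maximalRealSubfield L)) := by
    have e : y * η₀⁻¹ - 1 = (y - η₀) * η₀⁻¹ := by field_simp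
    rw [e, map_mul, map_inv₀, hη₀1, inv_one, mul_one]
    exact hξ₀
  obtain ⟨r, hr, -⟩ := exists_mul_self_eq_of_valued_sub_one_lt_four_adicCompletion ↥(maximalRealSubfield L) v (y * η₀⁻¹) hs
  have hy : y = η₀ * (r * r) := by rw [hr]; field_simp
  have hr0 : r ≠ 0 := by
    intro h0
    rw [h0, mul_zero, mul_zero] at hy
    exact hy0 hy
  -- the image of `ξ₀` at `w` is `ι_w y = η · ρ²`, `ρ := ι_w r` `σ_w`-fixed
  have hloc : algebraMap L (w.1.adicCompletion L) (ξ₀ : L) = toPlace v w y := (toPlace_coe v w ξ₀).symm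
  refine ⟨(ξ₀ : L), IsCMField.complexConj_apply_eq_self L ξ₀, ?_, ?_⟩
  · rw [hloc, valued_toPlace_eq_sq_of_ramified L v w hw he, hy1, one_pow]
  · rintro ⟨t', ht'⟩
    set ρ : w.1.adicCompletion L := toPlace v w r with hρdef
    have hσρ : galAdicCompletionMap (L := L) (IsCMField.complexConj L) hw ρ = ρ := by
      rw [hρdef, galAdicCompletionMap_toPlace]
    have hρ0 : ρ ≠ 0 := (map_ne_zero (toPlace v w)).2 hr0
    have key : t' * galAdicCompletionMap (L := L) (IsCMField.complexConj L) hw t' = η * (ρ * ρ) := by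
      rw [ht', hloc, hy, map_mul, map_mul, hη₀]
    apply hηnn
    refine ⟨t' * ρ⁻¹, ?_⟩
    rw [map_mul, map_inv₀, hσρ]
    field_simp
    linear_combination key

end Kit

/-! ## §2 The kit read in `L ⊗ L⁺_v = ∏_{w ∣ v} L_w` -/

section NonNormUnit

include hw he in
/-- **A GLOBAL NON-NORM UNIT AT A RAMIFIED PLACE, READ IN `L ⊗ L⁺_v = ∏_{w ∣ v} L_w`** (tame or wild).  Some `ξ ∈ L⁺ ⊂ L` has `|ξ|_w = 1`, `ξ_w ∉ N(L_w^×)`, its image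
`ι ξ ∈ L ⊗ L⁺_v` is a `(c ⊗ 1)`-fixed unit, and `ι ξ ≠ σ(z)·z` for every unit `z` of `L ⊗ L⁺_v` (read at the unique place `w` above `v`, ★ `conjLocal_apply_eq_of_smul_eq`).  The parity-free
form of ★ p856749 §1 `exists_global_unit_not_norm_localRing`. [cite: Serre1979, Ch. V §3 Cor. 2, Cor. 3] [cite: Omeara1963, §63B Prop. 63:13] -/
theorem exists_global_unit_not_norm_localRing_of_ramified :
    ∃ ξ : L, IsCMField.complexConj L ξ = ξ ∧
      Valued.v (algebraMap L (w.1.adicCompletion L) ξ) = 1 ∧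
      (¬ ∃ t : w.1.adicCompletion L, t * galAdicCompletionMap (L := L) (IsCMField.complexConj L) hw t = algebraMap L (w.1.adicCompletion L) ξ) ∧
      IsUnit (algebraMap L (LocalRing L v) ξ) ∧
      conjLocal L (IsCMField.complexConj L) v (algebraMap L (LocalRing L v) ξ) = algebraMap L (LocalRing L v) ξ ∧
      ¬ ∃ z : LocalRing L v, IsUnit z ∧ algebraMap L (LocalRing L v) ξ = conjLocal L (IsCMField.complexConj L) v z * z := by
  haveI : Algebra.IsQuadraticExtension ↥(maximalRealSubfield L) L := IsCMField.isQuadraticExtension L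
  obtain ⟨ξ, hξc, hξ1, hξnn⟩ := exists_global_unit_not_norm L v w hw he
  have hξ0 : ξ ≠ 0 := by
    intro h0
    rw [h0, map_zero, map_zero] at hξ1
    exact zero_ne_one hξ1
  refine ⟨ξ, hξc, hξ1, hξnn, (isUnit_iff_ne_zero.2 hξ0).map _, by rw [Literature.NumberTheory.Rogawski1990.conjLocal_algebraMap, hξc], ?_⟩
  rintro ⟨z, -, hz⟩
  -- read `ι ξ = σ(z)·z` at `w`: `ξ = σ_w(z_w) · z_w`
  have h := congrFun hz w
  rw [Pi.mul_apply, conjLocal_apply_eq_of_smul_eq (IsCMField.complexConj L) (IsCMField.complexConj_ne_one L) v w hw z] at h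
  exact hξnn ⟨z w, by rw [mul_comm]; exact h.symm⟩

end NonNormUnit

/-! ## §3 The block model of the compact sheet at any ramified place -/

include hherm hanis hw he in
set_option maxHeartbeats 1600000 in
/-- **«BLOCK MODEL OF THE COMPACT SHEET AT ANY RAMIFIED PLACE» (tame or wild).**  From the ‹J3 v2› frame (central point, dock `θ` with its `GL₃`-reading `y`, swap `W`, dock frame
`(G₁, G₂)`, bad frame `(P′, G₁′, G₂′)` with `det G₁′ ∉ det G₁ · N`, second class `ε′` framed by `P′`) at a non-split `v` RAMIFIED in `L` (`e(w|v) ≠ 1`; NO parity hypothesis):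
GLOBAL `ξ, c_b ∈ L⁺` with `|ξ|_w = 1`, `ξ_w ∉ N(L_w^×)`, `c_b ∈ {1, ξ}`, a congruence `T` with `ᵗ(σT) H′_v T = (!![1,0;0,−ξ] ⊕ᶠ !![c_b])_v`, and the block-scalar preimage
`x = φ_T⁻¹ ε′` with `mat x = a·1₂ ⊕ᶠ u·1₁`, `a − u` a unit.  ★ p856749 §2's proof token for token over the parity-free kit §2 (output `hξnn` in place of `hξN`).
[cite: Rogawski1990, §3.8 Prop. 3.8.1 (a),(d) p. 30; §8.1 p. 116] [cite: Jacobowitz1962, §3 Thm. 3.1; §§7–11] [cite: Serre1979, Ch. V §3 Cor. 2, Cor. 3] [cite: Omeara1963, §63B Prop. 63:13] -/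
theorem exists_blockModel_compactSheet_of_ramified
    (εH : ((cmDatum L 2 (Matrix.of fun i j : Fin 2 => if i.val + j.val + 1 = 2 then (1 : L) else 0)).Local v ×
      (cmDatum L 1 (Matrix.of fun i j : Fin 1 => if i.val + j.val + 1 = 1 then (1 : L) else 0)).Local v)) (a : LocalRing L v)
    (hu : (εH.2.val.val : Matrix (Fin 1) (Fin 1) (LocalRing L v)) 0 0 ≠ a)
    {ε : (cmDatum L 3 H').Local v} {y : GL (Fin 3) (LocalRing L v)}
    (θ : ((cmDatum L 2 (Matrix.of fun i j : Fin 2 => if i.val + j.val + 1 = 2 then (1 : L) else 0)).Local v ×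
      (cmDatum L 1 (Matrix.of fun i j : Fin 1 => if i.val + j.val + 1 = 1 then (1 : L) else 0)).Local v) ≃ₜ* ↥(Subgroup.centralizer ({ε} : Set ((cmDatum L 3 H').Local v))))
    (hθ : ∀ z : ((cmDatum L 2 (Matrix.of fun i j : Fin 2 => if i.val + j.val + 1 = 2 then (1 : L) else 0)).Local v ×
      (cmDatum L 1 (Matrix.of fun i j : Fin 1 => if i.val + j.val + 1 = 1 then (1 : L) else 0)).Local v),
      (((θ z).1).val : GL (Fin 3) (LocalRing L v)) = y * ((endoEmbLocal L v z).val : GL (Fin 3) (LocalRing L v)) * y⁻¹)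
    {W : GL (Fin 3) (LocalRing L v)} (hW : W.val = !![(1 : LocalRing L v), 0, 0; 0, 0, 1; 0, 1, 0])
    {G₁ G₁' : Matrix (Fin 2) (Fin 2) (LocalRing L v)} {G₂ G₂' : Matrix (Fin 1) (Fin 1) (LocalRing L v)} (P' : GL (Fin (2 + 1)) (LocalRing L v))
    (hPW : twistGram (conjLocal L (IsCMField.complexConj L) v) ((adelicForm L 3 H').map (adeleToLocal L v)) (y * W).val = finSum 2 1 G₁ G₂)
    (hP' : twistGram (conjLocal L (IsCMField.complexConj L) v) ((adelicForm L 3 H').map (adeleToLocal L v)) P'.val = finSum 2 1 G₁' G₂')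
    (hnn : ¬ ∃ z : LocalRing L v, IsUnit z ∧ G₁'.det = G₁.det * (conjLocal L (IsCMField.complexConj L) v z * z))
    (ε' : (cmDatum L 3 H').Local v)
    (hε' : (ε'.val.val : Matrix (Fin 3) (Fin 3) (LocalRing L v)) * P'.val =
      P'.val * finSum 2 1 (a • (1 : Matrix (Fin 2) (Fin 2) (LocalRing L v))) (εH.2.val.val : Matrix (Fin 1) (Fin 1) (LocalRing L v))) :
    ∃ (ξ cb : L), IsCMField.complexConj L ξ = ξ ∧ IsCMField.complexConj L cb = cb ∧
      Valued.v (algebraMap L (w.1.adicCompletion L) ξ) = 1 ∧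
      (¬ ∃ t : w.1.adicCompletion L, t * galAdicCompletionMap (L := L) (IsCMField.complexConj L) hw t = algebraMap L (w.1.adicCompletion L) ξ) ∧
      cb ≠ 0 ∧ (cb = 1 ∨ cb = ξ) ∧
      ∃ (T : GL (Fin (2 + 1)) (LocalRing L v))
        (hT : formCongr (conjLocal L (IsCMField.complexConj L) v) T (H'.map (algebraMap L (LocalRing L v))) =
          (1 : LocalRing L v) • (finSum 2 1 !![(1 : L), 0; 0, -ξ] !![cb]).map (algebraMap L (LocalRing L v)))
        (x : (cmDatum L (2 + 1) (finSum 2 1 !![(1 : L), 0; 0, -ξ] !![cb])).Local v),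
        IsUnit (a - (εH.2.val.val : Matrix (Fin 1) (Fin 1) (LocalRing L v)) 0 0) ∧
        mat L (2 + 1) (finSum 2 1 !![(1 : L), 0; 0, -ξ] !![cb]) v x =
          finSum 2 1 (a • (1 : Matrix (Fin 2) (Fin 2) (LocalRing L v))) (((εH.2.val.val : Matrix (Fin 1) (Fin 1) (LocalRing L v)) 0 0) • (1 : Matrix (Fin 1) (Fin 1) (LocalRing L v))) ∧
        cmDatumLocalCongr L v T isUnit_one hT x = ε' := by
  classical
  -- (0) the field `L ⊗ L⁺_v = L_w`, its involution `σ`, an anti-fixed `δ`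
  set σ := conjLocal L (IsCMField.complexConj L) v with hσdef
  have hF : IsField (LocalRing L v) := LocalRing.isField_of_smul_eq (IsCMField.complexConj L) (IsCMField.complexConj_ne_one L) w hw
  obtain ⟨x₀, hx₀⟩ := Literature.NumberTheory.NumberFields.IsCMField.exists_complexConj_ne L
  set δ : L := x₀ - IsCMField.complexConj L x₀ with hδdef
  have hcδ : IsCMField.complexConj L δ = -δ := by rw [hδdef, map_sub, IsCMField.complexConj_apply_apply, neg_sub]
  have hδ : δ ≠ 0 := fun h => hx₀ (sub_eq_zero.1 h).symm
  have hσσ : ∀ s, σ (σ s) = s := Liu2021.LemD1OfPlace.conjLocal_conjLocal_apply L v (IsCMField.complexConj L) hcδ hδ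
  have hdet' : H'.det ≠ 0 := Godement.det_ne_zero_of_anisotropic L H' hanis
  have hHv : (((adelicForm L 3 H').map (adeleToLocal L v)).map σ)ᵀ = (adelicForm L 3 H').map (adeleToLocal L v) :=
    map_conjLocal_transpose_localForm L 3 H' v hherm
  have hHvd : IsUnit ((adelicForm L 3 H').map (adeleToLocal L v)).det := UnitaryGroup.isUnit_det_localForm L 3 H' v hdet'
  have hunit_of_ne : ∀ {t : LocalRing L v}, t ≠ 0 → IsUnit t := fun {t} ht => by
    obtain ⟨s, hs⟩ := hF.mul_inv_cancel ht
    exact isUnit_iff_exists_inv.2 ⟨s, hs⟩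
  -- (1) blocks of the bad frame
  obtain ⟨hG₁'h, hgσ, hG₁'d, hgu⟩ := blocks_of_twistGram_eq_finSum σ hσσ hHv hHvd P' hP'
  -- (2) the bad block is anisotropic, the global unit `ξ` is not a norm, index two
  have hbad := not_exists_neg_det_badBlock_eq_norm L H' v w hw hherm hdet' θ hθ hW hPW hnn
  obtain ⟨ξ, hξc, hξ1, hξnn, hϖu, hϖσ', hϖnn⟩ := exists_global_unit_not_norm_localRing_of_ramified L v w hw he
  set ϖ : LocalRing L v := algebraMap L (LocalRing L v) ξ with hϖdef
  have hϖσ : σ ϖ = ϖ := hϖσ'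
  have hξ0 : ξ ≠ 0 := by
    intro h0
    rw [h0, map_zero, map_zero] at hξ1
    exact zero_ne_one hξ1
  have hdetσ : σ (-G₁'.det) = -G₁'.det := by
    rw [map_neg]
    congr 1
    have h := congrArg Matrix.det hG₁'h
    rwa [Matrix.det_transpose, ← RingHom.mapMatrix_apply, ← RingHom.map_det] at h
  obtain ⟨z₁, hz₁u, hz₁⟩ := exists_norm_mul_of_not_exists_norm L v (IsCMField.complexConj L) hcδ hδ w hw hϖσ hϖu hdetσ hG₁'d.neg
    (fun ⟨z, hz, h⟩ => hϖnn ⟨z, hz, h⟩) (fun ⟨z, hz, h⟩ => hbad ⟨z, hz, h⟩)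
  -- (3) the plane congruence `ᵗσ(S₁) G₁′ S₁ = ⟨1, −ξ⟩_v`
  have hHa : (!![(1 : L), 0; 0, -ξ]).map (algebraMap L (LocalRing L v)) = !![(1 : LocalRing L v), 0; 0, -ϖ] := by
    rw [hϖdef]
    ext i j; fin_cases i <;> fin_cases j <;> simp
  have hHah : ((!![(1 : LocalRing L v), 0; 0, -ϖ]).map σ)ᵀ = !![(1 : LocalRing L v), 0; 0, -ϖ] := by
    ext i j; fin_cases i <;> fin_cases j <;> simp [hϖσ]
  have hHad : IsUnit (!![(1 : LocalRing L v), 0; 0, -ϖ]).det := by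
    rw [Matrix.det_fin_two_of]; simpa using hϖu.neg
  have hdet : ∃ z : LocalRing L v, IsUnit z ∧ (!![(1 : LocalRing L v), 0; 0, -ϖ]).det = G₁'.det * (σ z * z) := by
    refine ⟨↑(hz₁u.unit⁻¹), (hz₁u.unit⁻¹).isUnit, ?_⟩
    rw [Matrix.det_fin_two_of]
    have h3 : z₁ * ↑(hz₁u.unit⁻¹) = 1 := hz₁u.mul_val_inv
    have h4 : σ z₁ * σ ↑(hz₁u.unit⁻¹) = 1 := by rw [← map_mul, h3, map_one]
    -- `−ϖ = det G₁′ · N(z₁⁻¹)` from `−det G₁′ = N(z₁) ϖ`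
    have key : G₁'.det = -(σ z₁ * z₁ * ϖ) := by rw [← hz₁, neg_neg]
    rw [key]
    have e : -(σ z₁ * z₁ * ϖ) * (σ ↑(hz₁u.unit⁻¹) * ↑(hz₁u.unit⁻¹)) = -ϖ * ((σ z₁ * σ ↑(hz₁u.unit⁻¹)) * (z₁ * ↑(hz₁u.unit⁻¹))) := by ring
    rw [e, h3, h4]; simp
  obtain ⟨S₁, hS₁⟩ := exists_formCongr_eq_of_det_eq_mul_norm L v (IsCMField.complexConj L) hcδ hδ w hw hG₁'h hHah hG₁'d hHad hdet
  -- (4) the line: `g = (G₂′)₀₀`, `c_b ∈ {1, ξ}`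
  set g : LocalRing L v := G₂' 0 0 with hgdef
  obtain ⟨s, cb, hsu, hcbc, hcb0, hcb1ξ, hcbloc⟩ : ∃ (s : LocalRing L v) (cb : L), IsUnit s ∧ IsCMField.complexConj L cb = cb ∧ cb ≠ 0 ∧ (cb = 1 ∨ cb = ξ) ∧
      algebraMap L (LocalRing L v) cb = σ s * g * s := by
    by_cases hg : ∃ z : LocalRing L v, IsUnit z ∧ g = σ z * z
    · obtain ⟨z, hzu, hz⟩ := hg
      refine ⟨↑(hzu.unit⁻¹), 1, (hzu.unit⁻¹).isUnit, map_one _, one_ne_zero, Or.inl rfl, ?_⟩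
      have h3 : z * ↑(hzu.unit⁻¹) = 1 := hzu.mul_val_inv
      have h4 : σ z * σ ↑(hzu.unit⁻¹) = 1 := by rw [← map_mul, h3, map_one]
      rw [map_one, hz]
      have e : σ ↑(hzu.unit⁻¹) * (σ z * z) * ↑(hzu.unit⁻¹) = (σ z * σ ↑(hzu.unit⁻¹)) * (z * ↑(hzu.unit⁻¹)) := by ring
      rw [e, h3, h4, mul_one]
    · obtain ⟨z, hzu, hz⟩ := exists_norm_mul_of_not_exists_norm L v (IsCMField.complexConj L) hcδ hδ w hw hϖσ hϖu hgσ hgu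
        (fun ⟨z, hz, h⟩ => hϖnn ⟨z, hz, h⟩) hg
      refine ⟨↑(hzu.unit⁻¹), ξ, (hzu.unit⁻¹).isUnit, hξc, hξ0, Or.inr rfl, ?_⟩
      have h3 : z * ↑(hzu.unit⁻¹) = 1 := hzu.mul_val_inv
      have h4 : σ z * σ ↑(hzu.unit⁻¹) = 1 := by rw [← map_mul, h3, map_one]
      rw [← hϖdef, hz]
      have e : σ ↑(hzu.unit⁻¹) * (σ z * z * ϖ) * ↑(hzu.unit⁻¹) = ϖ * ((σ z * σ ↑(hzu.unit⁻¹)) * (z * ↑(hzu.unit⁻¹))) := by ring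
      rw [e, h3, h4, mul_one, mul_one]
  obtain ⟨S₂, hS₂v, hS₂⟩ := exists_gl_one_formCongr_eq σ hsu G₂'
  have hHb : (!![cb]).map (algebraMap L (LocalRing L v)) = formCongr σ S₂ G₂' := by
    rw [hS₂, ← hcbloc]
    ext i j; fin_cases i; fin_cases j; simp
  -- (5) the congruence `T = P′ · (S₁ ⊕ᶠ S₂)`
  obtain ⟨S, hS, hSi⟩ := exists_gl_val_eq_finSum S₁ S₂
  have hP'f : formCongr σ P' (H'.map (algebraMap L (LocalRing L v))) = finSum 2 1 G₁' G₂' := by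
    rw [← Literature.NumberTheory.Rogawski1990.adelicForm_map_adeleToLocal L v H']; exact hP'
  have hT : formCongr σ (P' * S) (H'.map (algebraMap L (LocalRing L v))) =
      (1 : LocalRing L v) • (finSum 2 1 !![(1 : L), 0; 0, -ξ] !![cb]).map (algebraMap L (LocalRing L v)) := by
    rw [one_smul, finSum_map, formCongr_mul_of_finSum σ _ P' S S₁ S₂ hP'f hS, hS₁, hHa, hHb]
  -- (6) the block-scalar preimage `x = φ_T⁻¹ ε′`
  set φ := cmDatumLocalCongr L v (P' * S) isUnit_one hT with hφdef
  refine ⟨ξ, cb, hξc, hcbc, hξ1, hξnn, hcb0, hcb1ξ, P' * S, hT, φ.symm ε', hunit_of_ne (sub_ne_zero.2 hu.symm), ?_, φ.apply_symm_apply ε'⟩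
  -- the matrix of `x`: `(P′S)·mat x·(P′S)⁻¹ = ε′`
  have hconj : (P' * S) * (φ.symm ε').val * (P' * S)⁻¹ = ε'.val := by
    rw [← coe_cmDatumLocalCongr_apply L v (P' * S) isUnit_one hT (φ.symm ε')]
    exact congrArg Subtype.val (φ.apply_symm_apply ε')
  have hx1 : (φ.symm ε').val = S⁻¹ * (P'⁻¹ * ε'.val * P') * S := by
    rw [← hconj]; group
  have hPε : (P'⁻¹).val * (ε'.val.val : Matrix (Fin 3) (Fin 3) (LocalRing L v)) * P'.val =
      finSum 2 1 (a • (1 : Matrix (Fin 2) (Fin 2) (LocalRing L v))) (εH.2.val.val : Matrix (Fin 1) (Fin 1) (LocalRing L v)) := by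
    rw [Matrix.mul_assoc, hε', ← Matrix.mul_assoc, ← Units.val_mul, inv_mul_cancel, Units.val_one, Matrix.one_mul]
  have hx2 : ((P'⁻¹ * ε'.val * P' : GL (Fin (2 + 1)) (LocalRing L v)).val : Matrix (Fin (2 + 1)) (Fin (2 + 1)) (LocalRing L v)) =
      finSum 2 1 (a • (1 : Matrix (Fin 2) (Fin 2) (LocalRing L v))) (εH.2.val.val : Matrix (Fin 1) (Fin 1) (LocalRing L v)) := by
    rw [Units.val_mul, Units.val_mul]; exact hPε
  rw [mat_def, hx1, Units.val_mul, Units.val_mul, hx2, finSum_inv_mul_scalar_mul S S₁ S₂ hS hSi, ← fin_one_eq_smul_one]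

end Summit.HodgeConjecture.HodgeConjecture.Cruxes.H413.K2E3CompactSheetBlockModelWild

end
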